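import Mathlib
import Literature.Probability.LatticeModels.CornerFugacityMeasure
import Literature.Probability.Percolation.CardyFormula
import Literature.Probability.RandomPlanarGeometry.CardyFunction
import Literature.Probability.RandomPlanarGeometry.ConformalRectangle
import Literature.Barriers.CriticalPhenomena.EmbeddingModulusUniqueness

/-!
# Sketch (crux-ideate, ideator 3) — crux `CardyIKTransport.IKLinearTransport` (stmt-CriticalPhenomena-5076)

First lemmas of the idea cards `anchor-ward-shear-flow` and `smirnov-germ-continuation`, typed over
existing declarations only (`ikCrossingProb`, `moduliShear`, `cardyFunction`, `crossRatio`,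
`IsUniformizing`, `triDomainCrossingProb`).  Nothing is proved here.

Dictionary (Nienhuis 1990; Chelkak–Glazman–Smirnov arXiv:1604.06339 §2.1 at `s = 1`, `x = 1`): the
spectral parameter `u ∈ [π/3, π/2]` of the `n = 1` dilute `A₂⁽²⁾` family IS the rhombus angle of the
Z-invariant (isoradial) drawing.  In the tree's convention (`ikCoinBias u` = probability that the coin
joins the NE–SW pair `{w, w + (1,1)}`, all coins `true` at `u = π/3`) the NE–SW pair is the SHORT
diagonal, so the face `[w, w+1]²` is drawn as the parallelogram spanned by `1` and
`ikAngle u = e^{i(π-u)}` (obtuse angle `π - u` at `w`): `u = π/3` gives `e^{2πi/3}` (equilateral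
triangular lattice, Smirnov), `u = π/2` gives `i` (the square lattice itself, `moduliShear_I_apply`).
-/

noncomputable section

namespace Summit.CriticalPhenomena.CardyFormulaZ2.Cruxes.IKLinearTransport.IdeatorThree

open Filter Set
open scoped Topology
open Literature.Probability.RandomPlanarGeometry
open Literature.Probability.LatticeModels (ikCrossingProb)
open Literature.Barriers.CriticalPhenomena (moduliShear)
open UpperHalfPlane (upperHalfPlaneSet)

/-- The modulus `α_u = e^{i(π - u)}` of the Z-invariant drawing of `IK(u)`: the cell grid `ℤ²` is
drawn through Beffara's shear `moduliShear (ikAngle u)`, `(x, y) ↦ x + y·e^{i(π-u)}`. -/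
def ikAngle (u : ℝ) : ℂ := Complex.exp (((Real.pi - u : ℝ) : ℂ) * Complex.I)

/-- The real-linear map carrying the `u = π/3` (site-`𝕋`) picture to the `IK(u)` picture:
`γ_u = φ_{β_u}(α_{π/3})` with `φ_{β_u} = (moduliShear (ikAngle u))⁻¹` (`β_u = (i - Re α_u)/Im α_u`,
`moduliShear_connect`).  A window `R` seen by site-`𝕋` and the window `moduliShear (ikShift u) '' R`
seen by `IK(u)` have the same image in the conformal (isoradial) picture.  `ikShift (π/3) = i`
(identity), `ikShift (π/2) = e^{2πi/3}`. -/
def ikShift (u : ℝ) : ℂ :=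
  moduliShear ((Complex.I - ((ikAngle u).re : ℂ)) / ((ikAngle u).im : ℂ)) (ikAngle (Real.pi / 3))

/-- **First lemma of card `anchor-ward-shear-flow` (anchor Ward / shear-response law, continuum
form).**  For every conformal rectangle `R`, the right `u`-derivative AT THE TRIANGULAR POINT
`u = π/3` of the finite-mesh Izergin–Korepin crossing probabilities `u ↦ ikCrossingProb u R δ`
converges, as `δ → 0⁺`, to the right `u`-derivative at `π/3` of Cardy's value of the sheared
windows `moduliShear (ikAngle u) '' R` — i.e. Smirnov's percolation responds to the integrable
deformation, to first order, exactly as to the shear flow `u ↦ moduliShear (ikAngle u)`.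
`m` is any function recording the conformal modulus (cross-ratio of a uniformizing datum) of the
sheared window for `u ∈ [π/3, π/2]` (well defined by `crossRatio_eq_of_isUniformizing`, realised by
`R.map`).  Lattice mechanism: the YBE-derivative relation of Chelkak–Glazman–Smirnov (arXiv:1604.06339,
Cor. 2.6, valid at `s = 1` since it uses only the hexagon Yang–Baxter move near angle `π/3`) holds as
an insertion identity for every cell whose hexagon is not cut by `∂Ω`; double telescoping turns the
bulk Russo-type sum `d/du P_u(E)` into the first moment of the boundary defects (exact, finite `δ`);
the limit is a Hadamard variation evaluated with boundary 3-arm (pivotal) densities of site-`𝕋`. -/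
def AnchorShearResponse : Prop :=
  ∀ (R : ConformalRectangle) (m : ℝ → ℝ),
    (∀ u ∈ Set.Icc (Real.pi / 3) (Real.pi / 2), ∀ (R' : ConformalRectangle)
        (φ : ConformalEquiv upperHalfPlaneSet R'.carrier) (x : Fin 4 → ℝ),
        R'.carrier = moduliShear (ikAngle u) '' R.carrier →
        (∀ i, R'.pt i = moduliShear (ikAngle u) (R.pt i)) →
        R'.IsUniformizing φ x → m u = crossRatio x) →
    Tendsto (fun δ : ℝ => derivWithin (fun u : ℝ => ikCrossingProb u R δ) (Set.Ici (Real.pi / 3)) (Real.pi / 3))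
      (𝓝[>] 0) (𝓝 (derivWithin (fun u : ℝ => cardyFunction (m u)) (Set.Ici (Real.pi / 3)) (Real.pi / 3)))

/-- **Transfer `C⁺` of both cards (explicit-shear dictionary along the whole family).**  For every
`u ∈ [π/3, π/2]`: the `IK(u)` crossing probabilities of the shifted window `moduliShear (ikShift u) '' R`
and the site-`𝕋` (`u = π/3`) crossing probabilities of `R` have the same `δ → 0⁺` limits.  At
`u = π/2` (`ikShift (π/2) = e^{2πi/3}`, the map drawing `𝕋` equilaterally) this is the crux
`IKLinearTransport` with the EXPLICIT `K` (= identity after passing to the conformal picture), up to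
the bridge between the tree's free finite-volume gauge `ikCrossingProb` and the crux's inline
infinite-volume gauge.  Why easier than the crux: it is the integral of a DIFFERENTIAL statement in
`u` (the flow / the Taylor germ at `π/3`), which the single pair `(π/3, π/2)` does not expose. -/
def IKShearDictionary : Prop :=
  ∀ u ∈ Set.Icc (Real.pi / 3) (Real.pi / 2), ∀ (R R' : ConformalRectangle),
    R'.carrier = moduliShear (ikShift u) '' R.carrier →
    (∀ i, R'.pt i = moduliShear (ikShift u) (R.pt i)) →
    ∀ L : ℝ, Tendsto (ikCrossingProb (Real.pi / 3) R) (𝓝[>] 0) (𝓝 L) ↔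
      Tendsto (ikCrossingProb u R') (𝓝[>] 0) (𝓝 L)

/-- The same dictionary against the crux's `𝕋`-side object `triDomainCrossingProb` (Smirnov's model in
G02's discretisation): `IK(u)` on `R` has the limits of site-`𝕋` on the Z-invariantly drawn window
`moduliShear (ikAngle u) '' R` (at `u = π/2`, `ikAngle (π/2) = i` and `moduliShear i = id`: the crux's
`K` is the identity).  Limits only: at finite `δ` the two sides differ by a mirror, a collar and the
crossing-event convention. -/
def IKShearDictionaryTri : Prop :=
  ∀ u ∈ Set.Icc (Real.pi / 3) (Real.pi / 2), ∀ (R R' : ConformalRectangle),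
    R'.carrier = moduliShear (ikAngle u) '' R.carrier →
    (∀ i, R'.pt i = moduliShear (ikAngle u) (R.pt i)) →
    ∀ L : ℝ, Tendsto (ikCrossingProb u R) (𝓝[>] 0) (𝓝 L) ↔
      Tendsto (Literature.Probability.Percolation.triDomainCrossingProb R') (𝓝[>] 0) (𝓝 L)

/-- **First lemma of card `smirnov-germ-continuation` (normal family in complex `u`).**  The finite-mesh
crossing probability is a trigonometric rational function of `u`; extend it to complex `u` by the same
formula (complex corner fugacity `√3/(2 sin u)` and coin weight `sin(2π/3 - u)/sin u`).  Stated here in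
the weakest checkable REAL shadow that the line needs first and that is falsifiable by Monte Carlo:
the family `u ↦ ikCrossingProb u R δ` is uniformly Lipschitz on `[π/3, π/2]` as `δ → 0⁺`
(bounded `u`-derivative: the bulk Russo sum of `δ⁻²` terms of size `δ^{5/4}` cancels to `O(1)`). -/
def UniformLipschitzInU : Prop :=
  ∀ R : ConformalRectangle, ∃ C δ₀ : ℝ, 0 < δ₀ ∧ ∀ δ ∈ Set.Ioo 0 δ₀,
    ∀ u ∈ Set.Icc (Real.pi / 3) (Real.pi / 2), ∀ u' ∈ Set.Icc (Real.pi / 3) (Real.pi / 2),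
      |ikCrossingProb u R δ - ikCrossingProb u' R δ| ≤ C * |u - u'|

/-- Sanity: the composition bookkeeping of the two shears — `φ_{ikShift u}` is `φ_β ∘ φ_{α_{π/3}}`
with `φ_β` the inverse of `φ_{α_u}` (`moduliShear_moduliShear`). -/
example (u : ℝ) (z : ℂ) :
    moduliShear (ikShift u) z =
      moduliShear ((Complex.I - ((ikAngle u).re : ℂ)) / ((ikAngle u).im : ℂ))
        (moduliShear (ikAngle (Real.pi / 3)) z) := by
  unfold ikShift
  rw [Literature.Barriers.CriticalPhenomena.moduliShear_moduliShear]

end Summit.CriticalPhenomena.CardyFormulaZ2.Cruxes.IKLinearTransport.IdeatorThree
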